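import Literature.NumberTheory.EllipticCurves.EllCurveTorsionSubscheme
import Mathlib.CategoryTheory.Monoidal.Cartesian.Grp
import HarnessLib

/-!
# `E[N]` is a commutative `S`-group scheme and `E[N] ⟶ E` a homomorphism

Topic: `Literature/NumberTheory/EllipticCurves`. Complement to `EllCurveTorsionSubscheme.lean`
(`KugaSato.torsion E N = E[N]`, the fibre of `[N]` over the unit section, representing the
`N`-torsion points: `torsionPointsEquiv : (T ⟶ E[N]) ≃ {P : T ⟶ E // P ^ N = 1}`). For a
COMMUTATIVE `S`-group scheme `E` (every elliptic curve), the `N`-torsion `T`-points form a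
subgroup of `E(T)` functorially in `T`, so `E[N]` represents a presheaf of groups and is therefore
itself an `S`-group scheme (Mathlib `GrpObj.ofRepresentableBy`): Deligne's "schéma en groupes"
`E_n` of (3.6), the finite flat group scheme `E[N]` of Katz–Mazur (2.3) (finiteness and flatness
are NOT asserted here).

* `KugaSato.torsionPointsSubgroup E T N ≤ Hom(T, E)` — the `N`-torsion `T`-points (a subgroup:
  `(PQ)^N = P^N Q^N` by commutativity, `(P⁻¹)^N = (P^N)⁻¹`);
* `KugaSato.torsionPointsFunctor E N : (Over S)ᵒᵖ ⥤ GrpCat` and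
  `torsionRepresentableBy : (… ⋙ forget) .RepresentableBy (torsion E N)`;
* `KugaSato.grpObjTorsion : GrpObj (torsion E N)` — **`E[N]` is an `S`-group scheme**, with
  `torsion_one_comp_ι : η ≫ ι = η` and `torsion_mul_comp_ι : μ ≫ ι = (p₁ ≫ ι) · (p₂ ≫ ι)`, i.e.
  **`ι : E[N] ⟶ E` is a homomorphism** (`isMonHom_torsionι`), and `E[N]` is commutative
  (`isCommMonObj_torsion`).

All proved; no named facts.

## References

* P. Deligne, *Formes modulaires et représentations ℓ-adiques*, Sém. Bourbaki 355 (1969), (3.6).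
  [Deligne1971Bourbaki355]
* N. Katz, B. Mazur, *Arithmetic moduli of elliptic curves* (1985), (2.3), Thm. 2.3.1.
  [KatzMazur1985]
-/

universe u

open CategoryTheory Limits AlgebraicGeometry MonoidalCategory CartesianMonoidalCategory Opposite
open scoped MonObj

noncomputable section

namespace Literature.NumberTheory.EllipticCurves

namespace KugaSato

variable {S : Scheme.{u}} (E : Over S) [GrpObj E] [IsCommMonObj E]

/-! ### The presheaf of `N`-torsion points -/

/-- **The `N`-torsion `T`-points of a commutative `S`-group scheme form a subgroup of `E(T)`**
(`(PQ)^N = P^N Q^N` by commutativity, `(P⁻¹)^N = (P^N)⁻¹`). [folklore] -/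
def torsionPointsSubgroup (T : Over S) (N : ℕ) : Subgroup (T ⟶ E) where
  carrier := {P | P ^ N = 1}
  one_mem' := one_pow N
  mul_mem' {P Q} hP hQ := by
    change (P * Q) ^ N = 1
    rw [mul_pow, show P ^ N = 1 from hP, show Q ^ N = 1 from hQ, one_mul]
  inv_mem' {P} hP := by
    change P⁻¹ ^ N = 1
    rw [inv_pow, show P ^ N = 1 from hP, inv_one]

/-- Membership in `torsionPointsSubgroup`. [folklore] -/
@[simp]
theorem mem_torsionPointsSubgroup_iff (T : Over S) (N : ℕ) (P : T ⟶ E) :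
    P ∈ torsionPointsSubgroup E T N ↔ P ^ N = 1 :=
  Iff.rfl

/-- Precomposition with `φ : T ⟶ T'` restricted to `N`-torsion points (a group homomorphism:
precomposition preserves products, `MonObj.comp_mul`). [folklore] -/
def torsionPointsMap {T T' : Over S} (φ : T ⟶ T') (N : ℕ) :
    torsionPointsSubgroup E T' N →* torsionPointsSubgroup E T N where
  toFun P := ⟨φ ≫ P.1, by
    change (φ ≫ P.1) ^ N = 1
    rw [← MonObj.comp_pow, show P.1 ^ N = 1 from P.2, MonObj.comp_one]⟩
  map_one' := Subtype.ext (MonObj.comp_one φ)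
  map_mul' P Q := Subtype.ext (MonObj.comp_mul φ P.1 Q.1)

/-- Underlying point of `torsionPointsMap φ N P`. [folklore] -/
@[simp]
theorem torsionPointsMap_apply_coe {T T' : Over S} (φ : T ⟶ T') (N : ℕ)
    (P : torsionPointsSubgroup E T' N) :
    ((torsionPointsMap E φ N P : torsionPointsSubgroup E T N) : T ⟶ E) = φ ≫ P.1 :=
  rfl

/-- **The presheaf of groups `T ↦ E[N](T) = {P ∈ E(T) | P^N = 1}`** on `S`-schemes. [folklore] -/
def torsionPointsFunctor (N : ℕ) : (Over S)ᵒᵖ ⥤ GrpCat.{u} where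
  obj T := GrpCat.of (torsionPointsSubgroup E (unop T) N)
  map φ := GrpCat.ofHom (torsionPointsMap E φ.unop N)
  map_id T := by
    apply GrpCat.hom_ext
    apply MonoidHom.ext
    intro P
    apply Subtype.ext
    exact Category.id_comp P.1
  map_comp φ ψ := by
    apply GrpCat.hom_ext
    apply MonoidHom.ext
    intro P
    apply Subtype.ext
    exact Category.assoc _ _ _

/-- **`E[N]` represents the presheaf of `N`-torsion points** (`torsionPointsEquiv` of
`EllCurveTorsionSubscheme`, natural in `T`). [cite: Deligne1971Bourbaki355, (3.6)] -/
def torsionRepresentableBy (N : ℕ) :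
    (torsionPointsFunctor E N ⋙ forget GrpCat).RepresentableBy (torsion E N) where
  homEquiv {T} :=
    { toFun := fun f => (⟨f ≫ torsionι E N, comp_torsionι_pow E N f⟩ : torsionPointsSubgroup E T N)
      invFun := fun P => torsionLift E N P.1 P.2
      left_inv := fun _ => torsion_hom_ext E (torsionLift_ι E N _ _)
      right_inv := fun _ => Subtype.ext (torsionLift_ι E N _ _) }
  homEquiv_comp f g := by
    apply Subtype.ext
    exact Category.assoc _ _ _

/-- The universal property read through `torsionRepresentableBy`: the point attached to `f` is
`f ≫ ι`. [folklore] -/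
theorem torsionRepresentableBy_homEquiv'_apply_coe (N : ℕ) {T : Over S} (f : T ⟶ torsion E N) :
    ((torsionRepresentableBy E N).homEquiv' f).1 = f ≫ torsionι E N :=
  rfl

/-! ### The group scheme structure on `E[N]` -/

/-- **`E[N]` is an `S`-group scheme** (it represents a presheaf of groups; Mathlib
`GrpObj.ofRepresentableBy`). Deligne (3.6): the group scheme `E_n`; Katz–Mazur (2.3).
[cite: Deligne1971Bourbaki355, (3.6)] -/
instance grpObjTorsion (N : ℕ) : GrpObj (torsion E N) :=
  GrpObj.ofRepresentableBy (torsion E N) (torsionPointsFunctor E N) (torsionRepresentableBy E N)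

/-- **The unit of `E[N]` maps to the unit of `E`**: `η_{E[N]} ≫ ι = η_E`. [folklore] -/
theorem torsion_one_comp_ι (N : ℕ) : η[torsion E N] ≫ torsionι E N = η[E] := by
  have h1 : η[torsion E N] = (torsionRepresentableBy E N).homEquiv'.symm 1 := rfl
  have h2 := torsionRepresentableBy_homEquiv'_apply_coe E N (η[torsion E N])
  rw [← h2, h1, Equiv.apply_symm_apply]
  change (1 : 𝟙_ (Over S) ⟶ E) = η[E]
  rw [Hom.one_def, toUnit_unit, Category.id_comp]

/-- **The multiplication of `E[N]` is the restriction of that of `E`**: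
`μ_{E[N]} ≫ ι = (p₁ ≫ ι) · (p₂ ≫ ι)` in `Hom(E[N] × E[N], E)`. [folklore] -/
theorem torsion_mul_comp_ι (N : ℕ) :
    μ[torsion E N] ≫ torsionι E N =
      (fst (torsion E N) (torsion E N) ≫ torsionι E N) *
        (snd (torsion E N) (torsion E N) ≫ torsionι E N) := by
  have h1 : μ[torsion E N] = (torsionRepresentableBy E N).homEquiv'.symm
      ((torsionRepresentableBy E N).homEquiv' (fst (torsion E N) (torsion E N)) *
        (torsionRepresentableBy E N).homEquiv' (snd (torsion E N) (torsion E N))) := rfl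
  have h2 := torsionRepresentableBy_homEquiv'_apply_coe E N (μ[torsion E N])
  rw [← h2, h1, Equiv.apply_symm_apply]
  rfl

/-- **`ι : E[N] ⟶ E` is a homomorphism of `S`-group schemes.** [folklore] -/
instance isMonHom_torsionι (N : ℕ) : IsMonHom (torsionι E N) where
  one_hom := torsion_one_comp_ι E N
  mul_hom := by
    rw [torsion_mul_comp_ι, Hom.mul_def, lift_fst_comp_snd_comp]

/-- **`E[N]` is a commutative `S`-group scheme** (its multiplication is the restriction of the
commutative multiplication of `E`, and `ι` is a monomorphism). [folklore] -/
instance isCommMonObj_torsion (N : ℕ) : IsCommMonObj (torsion E N) where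
  mul_comm := by
    apply (cancel_mono (torsionι E N)).mp
    rw [Category.assoc, torsion_mul_comp_ι, MonObj.comp_mul, ← Category.assoc, ← Category.assoc,
      braiding_hom_fst, braiding_hom_snd, _root_.mul_comm]

end KugaSato

end Literature.NumberTheory.EllipticCurves

end
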